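import Literature.NumberTheory.GaloisRepresentations.GaloisH1MapBijectiveUnramified
import Literature.NumberTheory.GaloisCohomology.Howard2004.TowerMorphism
import HarnessLib

/-!
# The strict (ordinary) local condition is functorial in the module: `H¹(f)` maps `ker (H¹(W) → H¹(W/W⁺))` into
# `ker (H¹(W') → H¹(W'/W'⁺))` when `f(W⁺) ⊆ W'⁺`, with equality for a bijective `f` with `f(W⁺) = W'⁺`
# (theorems only; no definition, no named fact, no `sorry`)

Topic `NumberTheory/GaloisRepresentations` (companion of `BlochKatoSelmerGroup` — `DiscreteGaloisModule.quotientMap`,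
`strictSubgroup` — and of `GaloisH1MapBijectiveUnramified`, the same statements for the unramified condition).

Howard 2004 §3.1 (arXiv:1202.6340 p. 15 L56–66): `H¹_ord(K_v, ·) = im H¹(K_v, Fil_v ·) = ker (H¹(K_v, ·) → H¹(K_v, ·/Fil_v))`
is functorial in the module along maps preserving `Fil_v`; this is what makes the ordinary CORES of the tree's `F_𝔮`
(`OrdinaryFiltration.ordinaryCore`, `ZpExtensionEisensteinSelmerStructure`) compatible along the reductions and along the
`π`-adic refinement (the inputs `hCG`/`hCPG` of `PiRefinementDatum.isCartesianOnQuotAt_levelCondition_of_finite`,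
Howard's H.3 at `v ∣ p`).

* `DiscreteGaloisModule.map_mem_strictSubgroup` — `f(W⁺) ⊆ W'⁺ ⇒ H¹(f)(H¹_str(W)) ⊆ H¹_str(W')` (descend `f` to
  `W/W⁺ → W'/W'⁺` and use the naturality of `H¹(mkQ)`);
* `DiscreteGaloisModule.map_strictSubgroup_le`, **`map_strictSubgroup_eq_of_bijective`** — equality for an equivariant
  bijection with `f(W⁺) = W'⁺` (apply the inclusion to `f⁻¹ = ContIntertwiningMap.discreteSymm f`).

Everything is [folklore] functoriality of `H¹`, recorded against Howard §3.1 / Greenberg's ordinary condition.  Cell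
`pub/bsd-print-x9`, shared μ-item of rows 9/10 (D1 road, `SatisfiesH.h3` at `v ∣ p`); seat `bsd-line-x10b-p1-w6`.
BSD is not proved by any of this.
-/

set_option autoImplicit false

noncomputable section

open Function
open scoped ContRepresentation

namespace Literature.NumberTheory.GaloisRepresentations

namespace DiscreteGaloisModule

variable {F : Type} [Field F] {M N : Type} [AddCommGroup M] [TopologicalSpace M] [DiscreteTopology M]
  [AddCommGroup N] [TopologicalSpace N] [DiscreteTopology N]
  {ρ : DiscreteGaloisModule F M} {ρ' : DiscreteGaloisModule F N}

/-- **The strict condition is functorial**: for an equivariant `f : W → W'` with `f(W⁺) ⊆ W'⁺`,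
`H¹(f)` maps `ker (H¹(F, W) → H¹(F, W/W⁺))` into `ker (H¹(F, W') → H¹(F, W'/W'⁺))` (`f` descends to an equivariant
`f̄ : W/W⁺ → W'/W'⁺` with `H¹(mkQ') ∘ H¹(f) = H¹(f̄) ∘ H¹(mkQ)`).
[cite: Howard2004HeegnerKolyvagin, §3.1 (arXiv p. 15 L56–66: H¹_ord functorial in the module)] [cite: SerreGaloisCohomology1997, Ch. I §2.2] -/
theorem map_mem_strictSubgroup (f : ρ.toContRepresentation →ⁱL ρ'.toContRepresentation)
    (Wp : Submodule ℤ M) (h : ∀ σ : Field.absoluteGaloisGroup F, Wp ≤ Wp.comap (ρ σ))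
    (Wp' : Submodule ℤ N) (h' : ∀ σ : Field.absoluteGaloisGroup F, Wp' ≤ Wp'.comap (ρ' σ))
    (hf : ∀ w ∈ Wp, f w ∈ Wp') {x : galoisCohomology ρ 1} (hx : x ∈ ρ.strictSubgroup Wp h) :
    galoisCohomology.map f 1 x ∈ ρ'.strictSubgroup Wp' h' := by
  -- the descended map `f̄ : W/W⁺ → W'/W'⁺`
  let flin : M →ₗ[ℤ] N := f.toContinuousLinearMap.toLinearMap
  have hflin : Wp ≤ Wp'.comap flin := fun w hw ↦ hf w hw
  let fbar : (ρ.quotient Wp h).toContRepresentation →ⁱL (ρ'.quotient Wp' h').toContRepresentation :=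
    { toContinuousLinearMap := ⟨Wp.mapQ Wp' flin hflin, continuous_of_discreteTopology⟩
      isIntertwining' := fun σ ↦ by
        refine ContinuousLinearMap.ext fun q ↦ ?_
        induction q using Submodule.Quotient.induction_on with
        | _ w =>
          change Wp.mapQ Wp' flin hflin ((ρ.quotient Wp h) σ (Submodule.Quotient.mk w)) =
            (ρ'.quotient Wp' h') σ (Wp.mapQ Wp' flin hflin (Submodule.Quotient.mk w))
          rw [ContinuousRep.quotient_apply_mk, Submodule.mapQ_apply, Submodule.mapQ_apply,
            ContinuousRep.quotient_apply_mk]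
          exact congrArg _ (f.isIntertwining σ w) }
  -- naturality on cocycle classes
  have nat : ∀ y : galoisCohomology ρ 1,
      ρ'.quotientMap Wp' h' 1 (galoisCohomology.map f 1 y) =
        galoisCohomology.map fbar 1 (ρ.quotientMap Wp h 1 y) := by
    intro y
    obtain ⟨φ, rfl⟩ := oneCocycleClass_surjective ρ.toTopRep y
    change ContinuousCohomology.map _ _ 1 (ContinuousCohomology.map _ _ 1 _) =
      ContinuousCohomology.map _ _ 1 (ContinuousCohomology.map _ _ 1 _)
    rw [map_oneCocycleClass, map_oneCocycleClass, map_oneCocycleClass, map_oneCocycleClass]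
    exact congrArg _ (Subtype.ext (ContinuousMap.ext fun σ ↦ rfl))
  rw [mem_strictSubgroup_iff] at hx ⊢
  rw [nat, hx, map_zero]

/-- `H¹(f)(H¹_str(W, W⁺)) ≤ H¹_str(W', W'⁺)` when `f(W⁺) ⊆ W'⁺`. [cite: Howard2004HeegnerKolyvagin, §3.1 (arXiv p. 15 L56–66)] -/
theorem map_strictSubgroup_le (f : ρ.toContRepresentation →ⁱL ρ'.toContRepresentation)
    (Wp : Submodule ℤ M) (h : ∀ σ : Field.absoluteGaloisGroup F, Wp ≤ Wp.comap (ρ σ))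
    (Wp' : Submodule ℤ N) (h' : ∀ σ : Field.absoluteGaloisGroup F, Wp' ≤ Wp'.comap (ρ' σ))
    (hf : ∀ w ∈ Wp, f w ∈ Wp') :
    (ρ.strictSubgroup Wp h).map (galoisCohomology.map f 1) ≤ ρ'.strictSubgroup Wp' h' := by
  rintro _ ⟨x, hx, rfl⟩
  exact map_mem_strictSubgroup f Wp h Wp' h' hf hx

/-- **`H¹(f)(H¹_str(W, W⁺)) = H¹_str(W', W'⁺)` for a BIJECTIVE equivariant `f` with `f(W⁺) = W'⁺`** (the inverse
`f⁻¹` maps `W'⁺` into `W⁺`). Used to transport the ordinary cores between two presentations of the same level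
(`p`-adic level `k` ≅ `π`-adic level `mk`). [cite: Howard2004HeegnerKolyvagin, §3.1 and §1.6 (arXiv p. 15 L56–66, p. 12 L29–55)] -/
theorem map_strictSubgroup_eq_of_bijective (f : ρ.toContRepresentation →ⁱL ρ'.toContRepresentation)
    (hbij : Bijective f)
    (Wp : Submodule ℤ M) (h : ∀ σ : Field.absoluteGaloisGroup F, Wp ≤ Wp.comap (ρ σ))
    (Wp' : Submodule ℤ N) (h' : ∀ σ : Field.absoluteGaloisGroup F, Wp' ≤ Wp'.comap (ρ' σ))
    (hf : ∀ w ∈ Wp, f w ∈ Wp') (hf' : ∀ w' ∈ Wp', ∃ w ∈ Wp, f w = w') :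
    (ρ.strictSubgroup Wp h).map (galoisCohomology.map f 1) = ρ'.strictSubgroup Wp' h' := by
  refine le_antisymm (map_strictSubgroup_le f Wp h Wp' h' hf) fun y hy ↦ ?_
  have hinv : ∀ w' ∈ Wp', ContIntertwiningMap.discreteSymm f hbij w' ∈ Wp := by
    intro w' hw'
    obtain ⟨w, hw, rfl⟩ := hf' w' hw'
    rw [ContIntertwiningMap.discreteSymm_apply_apply]
    exact hw
  exact ⟨galoisCohomology.map (ContIntertwiningMap.discreteSymm f hbij) 1 y,
    map_mem_strictSubgroup _ Wp' h' Wp h hinv hy, galoisCohomology.map_map_discreteSymm f hbij y⟩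

end DiscreteGaloisModule

end Literature.NumberTheory.GaloisRepresentations

end
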